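import Literature.AlgebraicGeometry.Surfaces.PolarisedK3TwinKuranishiFamily
import Literature.AlgebraicGeometry.Surfaces.K3PeriodSurjectivityProofs
import Literature.AlgebraicGeometry.Surfaces.K3TwistorLines
import Literature.Dynamics.Homogeneous.OrthogonalGroupOrbitClosures
import Literature.AlgebraicGeometry.Surfaces.K3CMPeriodLattice

/-!
# Route NikulinTwinTransport · crux `K3PeriodSurjective` (stmt-HodgeConjecture-15154) —
# stub `stub_orbitClosureMeetsCM` of line `IdeatorOneSketch` (card `ratner-orbit-closure-cm-seed`)

Helper file for the line skeleton of crux `K3PeriodSurjective` (registered stub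
`stub_orbitClosureMeetsCM`, input T1 of the line). Notation: `Λ = Λ_{K3} = E₈(−1)^{⊕2} ⊕ U^{⊕3}`
(`k3Gram`, signature `(3,19)`), `D = k3PeriodDomain ⊂ Λ_ℂ = ℂ²²` (vectors `x` with `(x.x) = 0`,
`(x̄.x) > 0`; `D/ℂˣ` is the Grassmannian `Gr₊₊(Λ_ℝ)` of oriented positive `2`-planes
`l_x = ⟨Re x, Im x⟩_ℝ`, Huybrechts Ch. 6 Prop. 1.5 = `k3Period_iff_re_im`), `O(Λ)` / `SO(Λ)` the
integral matrices `g` with `gᵀ Λ g = Λ` (and `det g = 1`) acting by `x ↦ g x`. A period vector `y` is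
CM (`ρ = 20`) when twenty `ℤ`-independent lattice vectors are orthogonal to it, i.e. `l_y` is a
RATIONAL plane.

CLAIM (T1, `stub_orbitClosureMeetsCM`): for every `x ∈ D` the closure in `ℂ²²` of its
`O(Λ) × ℂˣ`-orbit `{t • g x}` contains a CM period vector. This is the only GLOBAL input of the line
and it is pure homogeneous dynamics (no K3 geometry): it follows from Verbitsky's classification of
the orbits of an arithmetic lattice `Γ ⊂ SO(V_ℤ)` on `Gr₊₊(V_ℝ)` for signatures `(a,b)`, `a > 2`
(Verbitsky, *Ergodic complex structures on hyperkähler manifolds: an erratum*, arXiv:1708.05802 §2.3,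
correcting Thm. 4.8 of Acta Math. 215 (2015)), itself a consequence of RATNER's orbit-closure theorem
for the unipotent-generated `SO⁺(a−2,b) ⊂ SO⁺(a,b)` and of the short list of intermediate subgroups.
Ratner's theorem is not in the tree; Verbitsky's theorem is the NAMED FACT
`Literature.Dynamics.Homogeneous.Verbitsky2017_orbitClosure_trichotomy_K3` (for `Λ_{K3}` and
`Γ = SO(Λ_{K3})`; stated by this seat, relocated by the gate to
`Literature/Dynamics/Homogeneous/OrthogonalGroupOrbitClosures.lean`, unproved debt), and the stub is
proved FROM it (`stub_orbitClosureMeetsCM_of`, the registered signature CONDITIONAL on that one fact,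
taken as the hypothesis `h`), by Verbitsky's three cases:

* (i) `l_x` rational: `y := x` lies in (the closure of) its own orbit (`orbitClosureMeetsCM_of_isCM`,
  the unconditional degenerate instance) and is CM — `exists_fin_twenty_linearIndependent_orthogonal`:
  for ANY two lattice vectors `u, w` the sublattice `{u, w}^⊥` has rank `≥ 22 − 2 = 20`
  (rank–nullity over `ℤ`), unconditional;
* (ii) `l_x` contains no lattice vector: the orbit is dense, so its closure contains the explicit CM
  point built on `⟨e₁ + f₁, v'⟩` (`exists_cmPeriod_re_eq`);
* (iii) `l_x ∩ Λ_ℚ = ℚ v`: the closure contains every positive plane through `v`; `v² > 0`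
  (`k3Lattice_pos_of_mem_periodPlane`) and `v^⊥` (signature `(2,19)`) contains a lattice vector `v'`
  with `v'² > 0` (`exists_orthogonal_pos_k3Lattice`, unconditional: `v' = (v.t₂) t₁ − (v.t₁) t₂` in
  the positive definite `⟨t₁, t₂⟩ = ⟨e₁ + f₁, e₂ + f₂⟩`), so the rational positive plane `⟨v, v'⟩`
  carries a CM period vector `y = v + i s v'` of the closure.

Sources read this session (held texts): arXiv:1708.05802 §1.1, §2.1–2.3, §4; arXiv:1306.1498 §4.1–4.2.
-/

noncomputable section

set_option linter.dupNamespace false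

open scoped Matrix Topology
open Literature.AlgebraicGeometry Literature.AlgebraicGeometry.Surfaces
  Literature.AlgebraicGeometry.HodgeTheory

namespace Summit.HodgeConjecture.HodgeConjecture.Theorems.NikulinTwinTransport

/-! ### Lattice linear algebra on `Λ_{K3}` (unconditional) -/

/-- **Twenty independent lattice vectors orthogonal to any two.** For `u, w ∈ Λ_{K3} ≅ ℤ²²` the
sublattice `{u, w}^⊥` — the kernel of `λ ↦ ((λ.u), (λ.w)) ∈ ℤ²` — has rank at least `22 − 2 = 20`
(rank–nullity over `ℤ`), hence contains twenty `ℤ`-linearly independent vectors. In particular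
the orthogonal complement of a rational plane has rank `20` ("`l` rational ⇒ `[x]` is CM"). -/
theorem exists_fin_twenty_linearIndependent_orthogonal (u w : K3Index → ℤ) :
    ∃ N : Fin 20 → (K3Index → ℤ), LinearIndependent ℤ N ∧
      ∀ k, (∑ i, ∑ j, N k i * k3Gram i j * u j = 0) ∧ (∑ i, ∑ j, N k i * k3Gram i j * w j = 0) := by
  classical
  let f : (K3Index → ℤ) →ₗ[ℤ] (Fin 2 → ℤ) :=
    Matrix.mulVecLin (Matrix.of ![k3Gram *ᵥ u, k3Gram *ᵥ w])
  have hdim : Module.finrank ℤ (LinearMap.range f) + Module.finrank ℤ (LinearMap.ker f) = 22 := by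
    rw [← f.quotKerEquivRange.finrank_eq, Submodule.finrank_quotient_add_finrank,
      Module.finrank_fintype_fun_eq_card]
    simp
  have hrange : Module.finrank ℤ (LinearMap.range f) ≤ 2 := by
    calc Module.finrank ℤ (LinearMap.range f)
        ≤ Module.finrank ℤ (Fin 2 → ℤ) := Submodule.finrank_le _
      _ = 2 := by rw [Module.finrank_fintype_fun_eq_card, Fintype.card_fin]
  have hker : 20 ≤ Module.finrank ℤ (LinearMap.ker f) := by omega
  obtain ⟨g, hg⟩ := exists_linearIndependent_of_le_finrank hker
  refine ⟨fun k => (g k : K3Index → ℤ),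
    hg.map' (LinearMap.ker f).subtype (Submodule.ker_subtype _), fun k => ?_⟩
  have hk : f (g k) = 0 := LinearMap.mem_ker.1 (g k).2
  have h0 := congrFun hk 0
  have h1 := congrFun hk 1
  simp only [f, Matrix.mulVecLin_apply, Matrix.mulVec, Matrix.of_apply, Matrix.cons_val_zero,
    Matrix.cons_val_one, Pi.zero_apply] at h0 h1
  refine ⟨?_, ?_⟩
  · rw [k3Lattice_sum_sum_eq_dotProduct, dotProduct_comm]
    exact h0
  · rw [k3Lattice_sum_sum_eq_dotProduct, dotProduct_comm]
    exact h1

/-- **A positive lattice vector orthogonal to a given one** (the lattice input of case (iii):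
"`v^⊥` has signature `(2,19)`, so it contains a rational `v'` with `v'² > 0`"), for EVERY
`v ∈ Λ_{K3}`: with `t₁ = e₁ + f₁`, `t₂ = e₂ + f₂` (pairwise orthogonal, `tₖ² = 2`, spanning with
`e₃ + f₃` the positive definite sublattice of `k3Lattice_pos_of_diag`), the vector
`v' = (v.t₂) t₁ − (v.t₁) t₂` — or `t₁` itself when `(v.t₁) = 0` — is orthogonal to `v`, non-zero,
and of positive square. -/
theorem exists_orthogonal_pos_k3Lattice (v : K3Index → ℤ) :
    ∃ v' : K3Index → ℤ, (∑ i, ∑ j, v i * k3Gram i j * v' j = 0) ∧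
      0 < ∑ i, ∑ j, v' i * k3Gram i j * v' j := by
  -- `t₁ = e₁ + f₁`, `t₂ = e₂ + f₂` in the coordinates `(E₈ ⊕ E₈) ⊕ (U ⊕ (U ⊕ U))`
  let t₁ : K3Index → ℤ := Sum.elim 0 (Sum.elim (fun _ => 1) 0)
  let t₂ : K3Index → ℤ := Sum.elim 0 (Sum.elim 0 (Sum.elim (fun _ => 1) 0))
  by_cases h₁ : ∑ i, ∑ j, v i * k3Gram i j * t₁ j = 0
  · refine ⟨t₁, h₁, k3Lattice_pos_of_diag (fun _ => rfl) rfl rfl rfl ?_⟩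
    intro h
    have h' := congrFun h (Sum.inr (Sum.inl 0))
    simp [t₁] at h'
  · set a₁ : ℤ := ∑ i, ∑ j, v i * k3Gram i j * t₁ j with ha₁
    set a₂ : ℤ := ∑ i, ∑ j, v i * k3Gram i j * t₂ j with ha₂
    refine ⟨a₂ • t₁ - a₁ • t₂, ?_, k3Lattice_pos_of_diag ?_ rfl rfl rfl ?_⟩
    · rw [k3Lattice_sum_sum_eq_dotProduct v (_ - _), Matrix.mulVec_sub, Matrix.mulVec_smul,
        Matrix.mulVec_smul, dotProduct_sub, dotProduct_smul, dotProduct_smul,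
        ← k3Lattice_sum_sum_eq_dotProduct, ← k3Lattice_sum_sum_eq_dotProduct, ← ha₁, ← ha₂,
        smul_eq_mul, smul_eq_mul]
      ring
    · intro i
      simp [t₁, t₂]
    · intro h
      have h' := congrFun h (Sum.inr (Sum.inr (Sum.inl 0)))
      have e₁ : t₁ (Sum.inr (Sum.inr (Sum.inl 0))) = 0 := rfl
      have e₂ : t₂ (Sum.inr (Sum.inr (Sum.inl 0))) = 1 := rfl
      rw [Pi.sub_apply, Pi.smul_apply, Pi.smul_apply, Pi.zero_apply, e₁, e₂, smul_zero,
        smul_eq_mul, mul_one, zero_sub, neg_eq_zero] at h'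
      exact h₁ h'

/-- **A non-zero lattice vector in a positive plane has positive square**: if `x ∈ D` and the
lattice vector `v ≠ 0` is a real combination `a Re x + b Im x`, then `(v.v) = (a² + b²)(Re x)² > 0`
(`Re x ⊥ Im x`, `(Re x)² = (Im x)² > 0`, Huybrechts Ch. 6 Prop. 1.5). -/
theorem k3Lattice_pos_of_mem_periodPlane {x : K3Index → ℂ} (hx : x ∈ k3PeriodDomain)
    {v : K3Index → ℤ} (hv0 : v ≠ 0) {a b : ℝ}
    (hv : ∀ i, (v i : ℝ) = a * (x i).re + b * (x i).im) :
    0 < ∑ i, ∑ j, v i * k3Gram i j * v j := by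
  obtain ⟨hC, hAB, hA⟩ := (mem_k3PeriodDomain_iff_k3RForm rfl x).1 hx
  have hvec : (fun i => (v i : ℝ)) = a • (fun i => (x i).re) + b • (fun i => (x i).im) := by
    funext i
    simp [hv i]
  have hq : ((∑ i, ∑ j, v i * k3Gram i j * v j : ℤ) : ℝ) =
      (a * a + b * b) *
        Matrix.toBilin' (k3Gram.map (Int.cast : ℤ → ℝ)) (fun i => (x i).re) (fun i => (x i).re) := by
    rw [← k3RForm_intCast, hvec, twistorChain_comb2 _ k3RForm_comm, hC, ← hAB]
    ring
  have hab : 0 < a * a + b * b := by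
    rcases (add_nonneg (mul_self_nonneg a) (mul_self_nonneg b)).lt_or_eq with h | h
    · exact h
    · exfalso
      have ha : a = 0 := by nlinarith [mul_self_nonneg a, mul_self_nonneg b]
      have hb : b = 0 := by nlinarith [mul_self_nonneg a, mul_self_nonneg b]
      apply hv0
      funext i
      have hi := hv i
      rw [ha, hb, zero_mul, zero_mul, add_zero] at hi
      exact_mod_cast hi
  have hpos : (0 : ℝ) < ((∑ i, ∑ j, v i * k3Gram i j * v j : ℤ) : ℝ) := by
    rw [hq]
    exact mul_pos hab hA
  exact_mod_cast hpos

/-- A lattice vector orthogonal (for the real form) to `Re y` and to `Im y` is `k3Form`-orthogonal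
to `y = Re y + i Im y`. -/
theorem k3Form_intCast_eq_zero_of_re_im {n : K3Index → ℤ} {y : K3Index → ℂ}
    (hre : Matrix.toBilin' (k3Gram.map (Int.cast : ℤ → ℝ)) (fun i => (n i : ℝ)) (fun i => (y i).re) = 0)
    (him : Matrix.toBilin' (k3Gram.map (Int.cast : ℤ → ℝ)) (fun i => (n i : ℝ)) (fun i => (y i).im) = 0) :
    k3Form (fun i => (n i : ℂ)) y = 0 := by
  have hy : y = (fun i => (((y i).re : ℝ) : ℂ)) + Complex.I • (fun i => (((y i).im : ℝ) : ℂ)) := by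
    funext i
    apply Complex.ext <;> simp
  rw [hy, k3Form_add_right, k3Form_smul_right, k3Form_intCast_eq_k3RForm, k3Form_intCast_eq_k3RForm,
    hre, him]
  simp

/-- **CM period vectors on rational positive planes.** For lattice vectors `p ⊥ q` of positive
squares, the rational positive plane `⟨p, q⟩` carries the period vector `y = p + i s q ∈ D`
(`s = √((p.p)/(q.q))`, `exists_k3Period_re_im`) with `Re y = p`, and `y` is CM: the twenty
independent lattice vectors of `{p, q}^⊥` are orthogonal to `y`. -/
theorem exists_cmPeriod_re_eq (p q : K3Index → ℤ) (hpq : ∑ i, ∑ j, p i * k3Gram i j * q j = 0)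
    (hp : 0 < ∑ i, ∑ j, p i * k3Gram i j * p j) (hq : 0 < ∑ i, ∑ j, q i * k3Gram i j * q j) :
    ∃ y : K3Index → ℂ, y ∈ k3PeriodDomain ∧ (∀ i, (y i).re = p i) ∧
      ∃ N : Fin 20 → (K3Index → ℤ), LinearIndependent ℤ N ∧
        ∀ k : Fin 20, k3Form (fun i => (N k i : ℂ)) y = 0 := by
  have huw : Matrix.toBilin' (k3Gram.map (Int.cast : ℤ → ℝ)) (fun i => (p i : ℝ)) (fun i => (q i : ℝ))
      = 0 := by
    rw [k3RForm_intCast, hpq, Int.cast_zero]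
  have hu : 0 < Matrix.toBilin' (k3Gram.map (Int.cast : ℤ → ℝ)) (fun i => (p i : ℝ))
      (fun i => (p i : ℝ)) := by
    rw [k3RForm_intCast]
    exact_mod_cast hp
  have hw : 0 < Matrix.toBilin' (k3Gram.map (Int.cast : ℤ → ℝ)) (fun i => (q i : ℝ))
      (fun i => (q i : ℝ)) := by
    rw [k3RForm_intCast]
    exact_mod_cast hq
  obtain ⟨s, hs⟩ := exists_k3Period_re_im rfl huw hu hw
  obtain ⟨N, hN, hNo⟩ := exists_fin_twenty_linearIndependent_orthogonal p q
  refine ⟨_, hs, fun i => rfl, N, hN, fun k => k3Form_intCast_eq_zero_of_re_im ?_ ?_⟩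
  · show Matrix.toBilin' (k3Gram.map (Int.cast : ℤ → ℝ)) (fun i => (N k i : ℝ)) (fun i => (p i : ℝ)) = 0
    rw [k3RForm_intCast, (hNo k).1, Int.cast_zero]
  · show Matrix.toBilin' (k3Gram.map (Int.cast : ℤ → ℝ)) (fun i => (N k i : ℝ))
      (s • fun i => (q i : ℝ)) = 0
    rw [LinearMap.BilinForm.smul_right, k3RForm_intCast, (hNo k).2, Int.cast_zero, mul_zero]

/-! ### The orbit cones -/

/-- `x` lies in its own `O(Λ) × ℂˣ`-orbit (`g = 1`, `t = 1`). -/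
theorem self_mem_k3OrbitCone (x : K3Index → ℂ) :
    x ∈ {z : K3Index → ℂ | ∃ (g : Matrix K3Index K3Index ℤ) (t : ℂ),
      g.transpose * k3Gram * g = k3Gram ∧ IsUnit g ∧ t ≠ 0 ∧ z = t • (g.map (Int.cast : ℤ → ℂ) *ᵥ x)} := by
  refine ⟨1, 1, by rw [Matrix.transpose_one, Matrix.one_mul, Matrix.mul_one], isUnit_one,
    one_ne_zero, ?_⟩
  rw [Matrix.map_one (Int.cast : ℤ → ℂ) Int.cast_zero Int.cast_one, Matrix.one_mulVec, one_smul]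

/-- **The degenerate instance of T1, unconditionally**: a CM period vector lies in the closure of
its own `O(Λ) × ℂˣ`-orbit, so for CM `x` the conclusion of `stub_orbitClosureMeetsCM` holds with
`y := x` (Verbitsky's case (i) needs no dynamics). -/
theorem orbitClosureMeetsCM_of_isCM {x : K3Index → ℂ} (hx : x ∈ k3PeriodDomain)
    (hCM : ∃ N : Fin 20 → (K3Index → ℤ), LinearIndependent ℤ N ∧
      ∀ k : Fin 20, k3Form (fun i => (N k i : ℂ)) x = 0) :
    ∃ y : K3Index → ℂ, y ∈ closure {z : K3Index → ℂ | ∃ (g : Matrix K3Index K3Index ℤ) (t : ℂ),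
      g.transpose * k3Gram * g = k3Gram ∧ IsUnit g ∧ t ≠ 0 ∧ z = t • (g.map (Int.cast : ℤ → ℂ) *ᵥ x)} ∧
      y ∈ k3PeriodDomain ∧ ∃ N : Fin 20 → (K3Index → ℤ), LinearIndependent ℤ N ∧
        ∀ k : Fin 20, k3Form (fun i => (N k i : ℂ)) y = 0 :=
  ⟨x, subset_closure (self_mem_k3OrbitCone x), hx, hCM⟩

/-- The `SO(Λ) × ℂˣ`-orbit is contained in the `O(Λ) × ℂˣ`-orbit (`det g = 1 ⇒ g` invertible over
`ℤ`). -/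
theorem k3SoOrbitCone_subset_orbitCone (x : K3Index → ℂ) :
    {z : K3Index → ℂ | ∃ (g : Matrix K3Index K3Index ℤ) (t : ℂ),
      g.transpose * k3Gram * g = k3Gram ∧ g.det = 1 ∧ t ≠ 0 ∧ z = t • (g.map (Int.cast : ℤ → ℂ) *ᵥ x)} ⊆
    {z : K3Index → ℂ | ∃ (g : Matrix K3Index K3Index ℤ) (t : ℂ),
      g.transpose * k3Gram * g = k3Gram ∧ IsUnit g ∧ t ≠ 0 ∧ z = t • (g.map (Int.cast : ℤ → ℂ) *ᵥ x)} := by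
  rintro z ⟨g, t, hg, hdet, ht, rfl⟩
  exact ⟨g, t, hg, (Matrix.isUnit_iff_isUnit_det g).2 (by rw [hdet]; exact isUnit_one), ht, rfl⟩

/-! ### T1 from the named fact -/

/-- **T1 · orbit closures meet the CM locus** (Verbitsky 2015 Thm. 4.8 + erratum arXiv:1708.05802
§2.3, via Ratner 1991, for the arithmetic lattice `O(Λ_{K3}) ⊂ O(3,19)`): for every period vector `x`
the closure of its `O(Λ) × ℂˣ`-orbit contains a period vector `y` with twenty independent lattice
vectors orthogonal to it. Pure homogeneous dynamics; no K3 geometry. The registered signature of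
`stub_orbitClosureMeetsCM`, CONDITIONAL on the named fact
`Literature.Dynamics.Homogeneous.Verbitsky2017_orbitClosure_trichotomy_K3` (hypothesis `h`), by its
three cases: (i) `l_x` rational — `y := x` (`exists_fin_twenty_linearIndependent_orthogonal`);
(ii) no lattice vector in `l_x` — the orbit is dense and its closure contains an explicit CM period
vector; (iii) a lattice `v ≠ 0` in the non-rational `l_x` — the closure contains the CM period
vector on the rational positive plane `⟨v, v'⟩`, `v' ∈ v^⊥ ∩ Λ` positive
(`exists_orthogonal_pos_k3Lattice`); the `SO(Λ)`-orbit of the fact lies in the `O(Λ)`-orbit of the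
statement. -/
theorem stub_orbitClosureMeetsCM_of
    (h : Literature.Dynamics.Homogeneous.Verbitsky2017_orbitClosure_trichotomy_K3) : ∀ x : K3Index → ℂ, x ∈ k3PeriodDomain → ∃ y : K3Index → ℂ, y ∈ closure {z : K3Index → ℂ | ∃ (g : Matrix K3Index K3Index ℤ) (t : ℂ), g.transpose * k3Gram * g = k3Gram ∧ IsUnit g ∧ t ≠ 0 ∧ z = t • (g.map (Int.cast : ℤ → ℂ) *ᵥ x)} ∧ y ∈ k3PeriodDomain ∧ ∃ N : Fin 20 → (K3Index → ℤ), LinearIndependent ℤ N ∧ ∀ k : Fin 20, k3Form (fun i => (N k i : ℂ)) y = 0 := by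
  intro x hx
  obtain ⟨-, hdense, hinter⟩ := h x hx
  have hsub := closure_mono (k3SoOrbitCone_subset_orbitCone x)
  by_cases hrat : ∃ (u w : K3Index → ℤ) (a b c d : ℝ), ∀ i,
      (x i).re = a * u i + b * w i ∧ (x i).im = c * u i + d * w i
  · -- (i) the plane of `x` is rational: `x` itself is CM and lies in its own orbit
    obtain ⟨u, w, a, b, c, d, huw⟩ := hrat
    obtain ⟨N, hN, hNo⟩ := exists_fin_twenty_linearIndependent_orthogonal u w
    refine orbitClosureMeetsCM_of_isCM hx ⟨N, hN, fun k => ?_⟩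
    have hre : (fun i => (x i).re) = a • (fun i => (u i : ℝ)) + b • (fun i => (w i : ℝ)) := by
      funext i
      simp [(huw i).1]
    have him : (fun i => (x i).im) = c • (fun i => (u i : ℝ)) + d • (fun i => (w i : ℝ)) := by
      funext i
      simp [(huw i).2]
    refine k3Form_intCast_eq_zero_of_re_im ?_ ?_
    · rw [hre, LinearMap.BilinForm.add_right, LinearMap.BilinForm.smul_right,
        LinearMap.BilinForm.smul_right, k3RForm_intCast, k3RForm_intCast, (hNo k).1, (hNo k).2]
      simp
    · rw [him, LinearMap.BilinForm.add_right, LinearMap.BilinForm.smul_right,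
        LinearMap.BilinForm.smul_right, k3RForm_intCast, k3RForm_intCast, (hNo k).1, (hNo k).2]
      simp
  by_cases hnone : ∀ v : K3Index → ℤ, (∃ a b : ℝ, ∀ i, (v i : ℝ) = a * (x i).re + b * (x i).im) → v = 0
  · -- (ii) no lattice vector in the plane: the orbit is dense; take any CM period vector
    obtain ⟨q, hpq, hq⟩ := exists_orthogonal_pos_k3Lattice (Sum.elim 0 (Sum.elim (fun _ => 1) 0))
    have hp : 0 < ∑ i, ∑ j, (Sum.elim 0 (Sum.elim (fun _ => 1) 0) : K3Index → ℤ) i * k3Gram i j *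
        (Sum.elim 0 (Sum.elim (fun _ => 1) 0) : K3Index → ℤ) j :=
      k3Lattice_pos_of_diag (fun _ => rfl) rfl rfl rfl (by
        intro h0
        have h' := congrFun h0 (Sum.inr (Sum.inl 0))
        simp at h')
    obtain ⟨y, hyD, -, hyCM⟩ := exists_cmPeriod_re_eq _ q hpq hp hq
    exact ⟨y, hsub (hdense hnone y hyD), hyD, hyCM⟩
  · -- (iii) a non-zero lattice vector `v` in the non-rational plane of `x`
    push Not at hnone
    obtain ⟨v, hvx, hv0⟩ := hnone
    obtain ⟨a, b, hab⟩ := hvx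
    have hvv : 0 < ∑ i, ∑ j, v i * k3Gram i j * v j := k3Lattice_pos_of_mem_periodPlane hx hv0 hab
    obtain ⟨v', hvv', hv'⟩ := exists_orthogonal_pos_k3Lattice v
    obtain ⟨y, hyD, hyre, hyCM⟩ := exists_cmPeriod_re_eq v v' hvv' hvv hv'
    refine ⟨y, hsub ((hinter v hv0 ⟨a, b, hab⟩ hrat).1 y hyD ⟨1, 0, fun i => ?_⟩), hyD, hyCM⟩
    rw [hyre i, one_mul, zero_mul, add_zero]

end Summit.HodgeConjecture.HodgeConjecture.Theorems.NikulinTwinTransport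

end
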